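import Literature.AlgebraicTopology.FundamentalGroup.VanKampenPushout
import HarnessLib

/-!
# Seifert–van Kampen for two open sets with epimorphic edge maps: `π₁(Y)` as a quotient of `π₁(U ∩ T)`

Topic `Literature/AlgebraicTopology/FundamentalGroup`; a corollary of the pushout form of the
Seifert–van Kampen theorem proved in `VanKampenPushout.lean` (Hatcher, *Algebraic Topology*
(2002), Thm. 1.20, two open sets).

Let `Y = U ∪ T` with `U`, `T` open, `x₀ ∈ U ∩ T`, and `U`, `T`, `U ∩ T` path connected, and
suppose that BOTH maps `π₁(U ∩ T, x₀) → π₁(U, x₀)` and `π₁(U ∩ T, x₀) → π₁(T, x₀)` induced by the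
inclusions are surjective.  Then the map `π₁(U ∩ T, x₀) → π₁(Y, x₀)` induced by the inclusion is
**surjective**, and its **kernel is the normal closure of `ker (π₁(U ∩ T) → π₁ U) ∪
ker (π₁(U ∩ T) → π₁ T)`** (`surjective_inclHom_inter_and_ker_eq`).  In other words the pushout
`π₁(U) *_{π₁(U ∩ T)} π₁(T)` of two *epimorphisms* is the quotient of `π₁(U ∩ T)` by the join of
their kernels — the form in which van Kampen's theorem computes the fundamental group of a
Heegaard splitting `H ∪_F H'` from the two handlebody kernels `ker (π₁ F → π₁ H)`,
`ker (π₁ F → π₁ H')`, and, iterated, the fundamental group of a trisected `4`-manifold from the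
three kernels (Abrams–Gay–Kirby's "group trisections"; inputs (T2), (T4) of
`Literature/Topology/FourManifolds/TrisectionFunctorGKProofs.lean`).

The theorem is first proved for an abstract group `Λ` with surjections `j_U : Λ ↠ π₁(U, x₀)`,
`j_T : Λ ↠ π₁(T, x₀)` such that `(i_U)_* ∘ j_U = (i_T)_* ∘ j_T` and every loop at `x₀` inside
`U ∩ T` has a common preimage in `Λ` (`surjective_and_ker_eq_normalClosure_of_epi`), which is what
the argument uses; `Λ = π₁(U ∩ T, x₀)` is the instance.

## Proof

Write `i = (i_U)_* ∘ j_U : Λ → π₁(Y, x₀)` and `N = ⟪ker j_U ∪ ker j_T⟫`.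
* *Surjectivity*: `π₁(Y, x₀)` is generated by the images of `π₁(U)` and `π₁(T)` (Hatcher's
  Lemma 1.15, `closure_range_inclHom_union_eq_top`), both of which are contained in the image of
  `i` because `j_U`, `j_T` are onto.
* `N ≤ ker i` because `i` kills `ker j_U` and, being also `(i_T)_* ∘ j_T`, kills `ker j_T`.
* `ker i ≤ N`: the quotient map `q : Λ → Λ ⧸ N` factors through the surjections `j_U`, `j_T` as
  `φ_U ∘ j_U = q = φ_T ∘ j_T` (`MonoidHom.liftOfSurjective`); `φ_U`, `φ_T` agree on the loops
  inside `U ∩ T` (they have common preimages in `Λ`), so the universal property of van Kampen's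
  theorem (`existsUnique_hom_of_cover`) gives `Φ : π₁(Y, x₀) → Λ ⧸ N` with `Φ ∘ (i_U)_* = φ_U`,
  whence `Φ ∘ i = q` and `ker i ≤ ker q = N`.

## Main statements

* `inclHomOfSubset` — `π₁(S, x₀) → π₁(S', x₀)` for `S ⊆ S'`, with
  `inclHomOfSubset_fromPath_liftPath`, `inclHom_comp_inclHomOfSubset` (functoriality);
* `surjective_and_ker_eq_normalClosure_of_epi` — the abstract form;
* `surjective_inclHom_inter_and_ker_eq` — the statement above for `Λ = π₁(U ∩ T, x₀)`.

## References

* A. Hatcher, *Algebraic Topology*, Cambridge Univ. Press (2002), §1.2, Lemma 1.15 and Thm. 1.20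
  (van Kampen's theorem: "the kernel of `Φ` is the normal subgroup `N` generated by all elements
  `i_{αβ}(ω) i_{βα}(ω)⁻¹`", which for surjective `i_{αβ}`, `i_{βα}` is the statement here).
  [HatcherAT2002]

## Design notes

* `_root_.FundamentalGroup` is written in full (the directory name shadows Mathlib's namespace
  inside `Literature.AlgebraicTopology.FundamentalGroup`, CONVENTIONS.md §2).
* No declaration in this file uses `sorry`.
-/

noncomputable section

open Set

namespace Literature.AlgebraicTopology.FundamentalGroup

namespace VanKampen

variable {Y : Type*} [TopologicalSpace Y]

/-! ### Inclusions of nested subspaces on fundamental groups -/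

section Nested

variable {S S' : Set Y} {x₀ : Y}

/-- The homomorphism `π₁(S, x₀) → π₁(S', x₀)` induced by an inclusion of subsets `S ⊆ S'` of `Y`
(both membership proofs of the base point are arguments, so that the target is literally
`π₁(S', ⟨x₀, hx'⟩)`). [folklore] -/
def inclHomOfSubset (h : S ⊆ S') (x₀ : Y) (hx : x₀ ∈ S) (hx' : x₀ ∈ S') :
    _root_.FundamentalGroup S ⟨x₀, hx⟩ →* _root_.FundamentalGroup S' ⟨x₀, hx'⟩ :=
  _root_.FundamentalGroup.mapOfEq (ContinuousMap.inclusion h) rfl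

/-- `inclHomOfSubset` on the class of the lift to `S` of a loop of `Y` inside `S` is the class of
its lift to `S'`. [folklore] -/
theorem inclHomOfSubset_fromPath_liftPath (h : S ⊆ S') (hx : x₀ ∈ S) (hx' : x₀ ∈ S')
    (δ : Path x₀ x₀) (hδ : ∀ t, δ t ∈ S) :
    inclHomOfSubset h x₀ hx hx'
        (_root_.FundamentalGroup.fromPath (Path.Homotopic.Quotient.mk (liftPath S δ hδ))) =
      _root_.FundamentalGroup.fromPath
        (Path.Homotopic.Quotient.mk (liftPath S' δ fun t => h (hδ t))) := by
  rw [inclHomOfSubset, _root_.FundamentalGroup.mapOfEq_apply]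
  rfl

/-- Functoriality: `π₁(S) → π₁(S') → π₁(Y)` is `π₁(S) → π₁(Y)`. [folklore] -/
theorem inclHom_comp_inclHomOfSubset (h : S ⊆ S') (hx : x₀ ∈ S) (hx' : x₀ ∈ S') :
    (inclHom S' x₀ hx').comp (inclHomOfSubset h x₀ hx hx') = inclHom S x₀ hx := by
  ext a
  induction a using PushoutData.ind_fromPath with
  | h δ =>
    rw [MonoidHom.comp_apply]
    simp only [inclHomOfSubset, inclHom, _root_.FundamentalGroup.mapOfEq_apply]
    rfl

/-- Pointwise functoriality. [folklore] -/
theorem inclHom_inclHomOfSubset (h : S ⊆ S') (hx : x₀ ∈ S) (hx' : x₀ ∈ S')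
    (a : _root_.FundamentalGroup S ⟨x₀, hx⟩) :
    inclHom S' x₀ hx' (inclHomOfSubset h x₀ hx hx' a) = inclHom S x₀ hx a :=
  DFunLike.congr_fun (inclHom_comp_inclHomOfSubset h hx hx') a

end Nested

/-! ### The epimorphic form of van Kampen's theorem -/

section Epi

variable {U T : Set Y} {x₀ : Y} {Λ : Type*} [Group Λ]

/-- **Seifert–van Kampen, epimorphic form (abstract edge group).**  Let `Y = U ∪ T` with `U`,
`T` open, `x₀ ∈ U ∩ T`, `U`, `T`, `U ∩ T` path connected; let `j_U : Λ → π₁(U, x₀)`,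
`j_T : Λ → π₁(T, x₀)` be SURJECTIVE homomorphisms with `(i_U)_* ∘ j_U = (i_T)_* ∘ j_T`, such
that every loop at `x₀` inside `U ∩ T` has a common preimage: some `l ∈ Λ` with `j_U l`, `j_T l`
the classes of the loop in `π₁(U)`, `π₁(T)`.  Then `i = (i_U)_* ∘ j_U : Λ → π₁(Y, x₀)` is
surjective and `ker i` is the normal closure of `ker j_U ∪ ker j_T` (Hatcher, Thm. 1.20: `Φ` is
onto by Lemma 1.15 and its kernel is normally generated by the `i_{αβ}(ω) i_{βα}(ω)⁻¹`; for
epimorphic edge maps this is the quotient of the edge group by the join of the kernels).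
[cite: HatcherAT2002, Thm. 1.20] -/
theorem surjective_and_ker_eq_normalClosure_of_epi (hUo : IsOpen U) (hTo : IsOpen T)
    (hcov : U ∪ T = univ) (hxU : x₀ ∈ U) (hxT : x₀ ∈ T) (hUpc : IsPathConnected U)
    (hTpc : IsPathConnected T) (hmeet : IsPathConnected (U ∩ T))
    (jU : Λ →* _root_.FundamentalGroup U ⟨x₀, hxU⟩) (jT : Λ →* _root_.FundamentalGroup T ⟨x₀, hxT⟩)
    (hjU : Function.Surjective jU) (hjT : Function.Surjective jT)
    (hcomm : (inclHom U x₀ hxU).comp jU = (inclHom T x₀ hxT).comp jT)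
    (hlift : ∀ (δ : Path x₀ x₀) (hU : ∀ t, δ t ∈ U) (hT : ∀ t, δ t ∈ T), ∃ l : Λ,
      jU l = _root_.FundamentalGroup.fromPath (Path.Homotopic.Quotient.mk (liftPath U δ hU)) ∧
      jT l = _root_.FundamentalGroup.fromPath (Path.Homotopic.Quotient.mk (liftPath T δ hT))) :
    Function.Surjective ((inclHom U x₀ hxU).comp jU) ∧
      ((inclHom U x₀ hxU).comp jU).ker = Subgroup.normalClosure ((jU.ker : Set Λ) ∪ jT.ker) := by
  set i := (inclHom U x₀ hxU).comp jU with hi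
  have hiT : i = (inclHom T x₀ hxT).comp jT := hcomm
  constructor
  · -- surjectivity: `π₁(Y)` is generated by the images of `π₁(U)` and `π₁(T)` (Lemma 1.15)
    have hgen := closure_range_inclHom_union_eq_top hUo hTo hcov hxU hxT hUpc hTpc hmeet
    have hrU : Set.range (inclHom U x₀ hxU) ⊆ Set.range i := by
      rintro _ ⟨a, rfl⟩
      obtain ⟨l, rfl⟩ := hjU a
      exact ⟨l, rfl⟩
    have hrT : Set.range (inclHom T x₀ hxT) ⊆ Set.range i := by
      rintro _ ⟨a, rfl⟩
      obtain ⟨l, rfl⟩ := hjT a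
      exact ⟨l, by rw [hiT]; rfl⟩
    have htop : i.range = ⊤ := by
      rw [eq_top_iff, ← hgen, Subgroup.closure_le, MonoidHom.coe_range]
      exact Set.union_subset hrU hrT
    exact MonoidHom.range_eq_top.1 htop
  · apply le_antisymm
    · -- `ker i ≤ N`: factor the quotient map through `j_U`, `j_T` and use the universal property
      set N := Subgroup.normalClosure ((jU.ker : Set Λ) ∪ jT.ker) with hN
      let q : Λ →* Λ ⧸ N := QuotientGroup.mk' N
      have hqU : jU.ker ≤ q.ker := by
        rw [QuotientGroup.ker_mk']
        exact fun x hx => Subgroup.subset_normalClosure (Or.inl hx)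
      have hqT : jT.ker ≤ q.ker := by
        rw [QuotientGroup.ker_mk']
        exact fun x hx => Subgroup.subset_normalClosure (Or.inr hx)
      let φU : _root_.FundamentalGroup U ⟨x₀, hxU⟩ →* Λ ⧸ N := jU.liftOfSurjective hjU ⟨q, hqU⟩
      let φT : _root_.FundamentalGroup T ⟨x₀, hxT⟩ →* Λ ⧸ N := jT.liftOfSurjective hjT ⟨q, hqT⟩
      have hφU : ∀ l, φU (jU l) = q l := fun l =>
        jU.liftOfRightInverse_comp_apply _ _ ⟨q, hqU⟩ l
      have hφT : ∀ l, φT (jT l) = q l := fun l =>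
        jT.liftOfRightInverse_comp_apply _ _ ⟨q, hqT⟩ l
      obtain ⟨Φ, ⟨hΦU, -⟩, -⟩ := existsUnique_hom_of_cover hUo hTo hcov hxU hxT hUpc hTpc hmeet
        φU φT (fun δ hU hT => by
          obtain ⟨l, hlU, hlT⟩ := hlift δ hU hT
          rw [← hlU, ← hlT, hφU, hφT])
      intro x hx
      rw [MonoidHom.mem_ker] at hx
      have hq : q x = 1 := by
        rw [← hφU, ← hΦU, MonoidHom.comp_apply]
        change Φ (i x) = 1
        rw [hx, map_one]
      rwa [QuotientGroup.mk'_apply, QuotientGroup.eq_one_iff] at hq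
    · -- `N ≤ ker i`
      refine Subgroup.normalClosure_le_normal ?_
      rintro x (hx | hx)
      · rw [SetLike.mem_coe, MonoidHom.mem_ker] at hx ⊢
        rw [hi, MonoidHom.comp_apply, hx, map_one]
      · rw [SetLike.mem_coe, MonoidHom.mem_ker] at hx ⊢
        rw [hiT, MonoidHom.comp_apply, hx, map_one]

/-- **Seifert–van Kampen, epimorphic form.**  Let `Y = U ∪ T` with `U`, `T` open, `x₀ ∈ U ∩ T`,
and `U`, `T`, `U ∩ T` path connected, and suppose the maps `π₁(U ∩ T, x₀) → π₁(U, x₀)` and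
`π₁(U ∩ T, x₀) → π₁(T, x₀)` induced by the inclusions are both surjective.  Then
`π₁(U ∩ T, x₀) → π₁(Y, x₀)` is surjective, with kernel the normal closure of
`ker (π₁(U ∩ T) → π₁ U) ∪ ker (π₁(U ∩ T) → π₁ T)`: the pushout `π₁(U) *_{π₁(U ∩ T)} π₁(T)` of
van Kampen's theorem, for epimorphic edge maps, is `π₁(U ∩ T) ⧸ ⟪ker ∪ ker⟫` (Hatcher, Thm. 1.20
with Lemma 1.15).  This is the form used for Heegaard splittings and trisections.
[cite: HatcherAT2002, Thm. 1.20] -/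
theorem surjective_inclHom_inter_and_ker_eq (hUo : IsOpen U) (hTo : IsOpen T)
    (hcov : U ∪ T = univ) (hxU : x₀ ∈ U) (hxT : x₀ ∈ T) (hUpc : IsPathConnected U)
    (hTpc : IsPathConnected T) (hmeet : IsPathConnected (U ∩ T))
    (hjU : Function.Surjective (inclHomOfSubset (inter_subset_left : U ∩ T ⊆ U) x₀ ⟨hxU, hxT⟩ hxU))
    (hjT : Function.Surjective
      (inclHomOfSubset (inter_subset_right : U ∩ T ⊆ T) x₀ ⟨hxU, hxT⟩ hxT)) :
    Function.Surjective (inclHom (U ∩ T) x₀ ⟨hxU, hxT⟩) ∧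
      (inclHom (U ∩ T) x₀ ⟨hxU, hxT⟩).ker = Subgroup.normalClosure
        (((inclHomOfSubset (inter_subset_left : U ∩ T ⊆ U) x₀ ⟨hxU, hxT⟩ hxU).ker : Set _) ∪
          (inclHomOfSubset (inter_subset_right : U ∩ T ⊆ T) x₀ ⟨hxU, hxT⟩ hxT).ker) := by
  have h := surjective_and_ker_eq_normalClosure_of_epi hUo hTo hcov hxU hxT hUpc hTpc hmeet
    (inclHomOfSubset (inter_subset_left : U ∩ T ⊆ U) x₀ ⟨hxU, hxT⟩ hxU)
    (inclHomOfSubset (inter_subset_right : U ∩ T ⊆ T) x₀ ⟨hxU, hxT⟩ hxT) hjU hjT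
    (by rw [inclHom_comp_inclHomOfSubset, inclHom_comp_inclHomOfSubset])
    (fun δ hU hT => ⟨_root_.FundamentalGroup.fromPath
        (Path.Homotopic.Quotient.mk (liftPath (U ∩ T) δ fun t => ⟨hU t, hT t⟩)),
      inclHomOfSubset_fromPath_liftPath _ _ _ δ _, inclHomOfSubset_fromPath_liftPath _ _ _ δ _⟩)
  rwa [inclHom_comp_inclHomOfSubset] at h

end Epi

end VanKampen

end Literature.AlgebraicTopology.FundamentalGroup

end
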